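import Summits.Parity.GeneralizedHardyLittlewood.Theorems.BeyondDiagonalBeatsQuarter.OffDiagHeartCoreSplit
import HarnessLib

/-!
# Route `PrimeLevelFamEdge`, crux K_B (stmt-Parity-20343), line `diagonal_kernel_split` rev 4, plan Ω,
# **L9″ (instantiated, three-way split) — every a8 piece may carry an unfunded part into the residual**

`OffDiagHeartCoreSplit.offDiagBelowSlack_io_of_coreSplit` (p651520) splits only the principal piece `coreP = FP + U`. L7d part 2
(prover-6) funds `coreL` only on its DOMAIN `D` (balanced boxes, long windows, bulk) and routes `coreL_{¬D}` to the residual;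
the same may happen for `coreX`. This file is the symmetric form: each of `coreP`, `coreL_{Rf}`, `coreX` is split on the good
primes as `F_• + U_•`, the three `F_•` are funded (eventually `≤ ε·Σms`, every `ε > 0`), and the residual slot is
`coreS_{Rf} + U_P + U_L + U_X` with the clean-scale block bound:

* **`offDiagBelowSlack_io_of_coreSplit₃`** — `stub_offDiagBelowSlack_io` VERBATIM from that data (via
  `OffDiagHeartPieces.offDiagBelowSlack_io_of_pieces_coreHeight` with the single funded piece `coreP + coreL + coreX` and
  `OffDiagHeartCoreSplit.sum_offDiagCore_goodPrimes_eq_pieces`).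

Helper; closes nothing; no definitions; standard axioms. «The programme SEARCHES and TYPES; no claim about Landau–Siegel
zeros, Theorems 1–2 of arXiv:2211.02515 or a repaired Margin232 until a kernel theorem says so.»
-/

noncomputable section

open Finset Polynomial
open scoped Real

namespace Summit.Parity.GeneralizedHardyLittlewood.Theorems.BeyondDiagonalBeatsQuarter.OffDiag

open Literature.NumberTheory.LFunctions Literature.NumberTheory.LFunctions.KMV2000
open PeterssonSplit (offDiag)

/-- **L9″ with a three-way split.** For `ε₀ ∈ (0,1]`, a conductor cut-off `Rf Δ′ N ≥ 1`, splits on the good primes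
`coreP = FP + UP`, `coreL_{Rf} = FL + UL`, `coreX = FX + UX` (`Δ′ ∈ (1,2)`), the three FUNDED parts `FP`, `FL`, `FX`
(each eventually `≤ ε·Σ ms` for every `ε > 0`), and the clean-scale residual block bound for `coreS_{Rf} + UP + UL + UX` with
SOME tolerance `U′ < 4(Δ′−1)/Δ′` (`c₀′`-first shell), `stub_offDiagBelowSlack_io` holds VERBATIM.
[cite: MontgomeryVaughan2007, Cor. 11.10 (Page); KowalskiMichelVanderKam2000, §6 p. 19 — derivation] -/
theorem offDiagBelowSlack_io_of_coreSplit₃ {ε₀ : ℝ} (hε₀ : 0 < ε₀) (hε₁ : ε₀ ≤ 1) (Rf : ℝ → ℕ → ℕ)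
    (hRf : ∀ (Δ' : ℝ) (N : ℕ), 1 ≤ Rf Δ' N) (FP UP FL UL FX UX : ℝ → ℕ → ℝ)
    (hPsplit : ∀ Δ' : ℝ, 1 < Δ' → Δ' < 2 → ∀ N : ℕ,
      coreP (goodPrimes Δ' N) (coreHeight ε₀) Δ' = FP Δ' N + UP Δ' N)
    (hLsplit : ∀ Δ' : ℝ, 1 < Δ' → Δ' < 2 → ∀ N : ℕ,
      coreL (Rf Δ' N) (goodPrimes Δ' N) (coreHeight ε₀) Δ' = FL Δ' N + UL Δ' N)
    (hXsplit : ∀ Δ' : ℝ, 1 < Δ' → Δ' < 2 → ∀ N : ℕ,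
      coreX (goodPrimes Δ' N) (coreHeight ε₀) Δ' = FX Δ' N + UX Δ' N)
    (hFP : ∀ Δ' : ℝ, 1 < Δ' → Δ' < 2 → ∀ ε : ℝ, 0 < ε → ∃ N₀ : ℕ, ∀ N : ℕ, N₀ ≤ N →
      FP Δ' N ≤ ε * ∑ q ∈ goodPrimes Δ' N, mainScaleReal Δ' q)
    (hFL : ∀ Δ' : ℝ, 1 < Δ' → Δ' < 2 → ∀ ε : ℝ, 0 < ε → ∃ N₀ : ℕ, ∀ N : ℕ, N₀ ≤ N →
      FL Δ' N ≤ ε * ∑ q ∈ goodPrimes Δ' N, mainScaleReal Δ' q)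
    (hFX : ∀ Δ' : ℝ, 1 < Δ' → Δ' < 2 → ∀ ε : ℝ, 0 < ε → ∃ N₀ : ℕ, ∀ N : ℕ, N₀ ≤ N →
      FX Δ' N ≤ ε * ∑ q ∈ goodPrimes Δ' N, mainScaleReal Δ' q)
    (hR : ∀ c₀' : ℝ, 0 < c₀' → ∃ b : ℝ, 1 < b ∧ ∀ Δ' : ℝ, 1 < Δ' → Δ' < b →
      ∃ U' : ℝ, U' < 4 * (Δ' - 1) / Δ' ∧ ∃ a₀ : ℝ, 0 < a₀ ∧ ∃ η' : ℝ, 0 < η' ∧ η' < c₀' / a₀ ∧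
        ∃ N₀ : ℕ, ∀ N : ℕ, N₀ ≤ N → CleanScale a₀ η' N →
          coreS (Rf Δ' N) (goodPrimes Δ' N) (coreHeight ε₀) Δ' + UP Δ' N + UL Δ' N + UX Δ' N ≤
            U' * ∑ q ∈ goodPrimes Δ' N, mainScaleReal Δ' q) :
    ∃ b : ℝ, 1 < b ∧ ∀ Δ' : ℝ, 1 < Δ' → Δ' < b → ∃ U : ℝ, U < 4 * (Δ' - 1) / Δ' ∧
      ∀ q₀ : ℕ, ∃ q : ℕ, ∃ _ : NeZero q, q₀ ≤ q ∧ q.Prime ∧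
        (∀ n : ℕ, (n : ℝ) ≠ qhat q ^ Δ') ∧
          -(∑ l ∈ Icc 1 ⌊qhat q ^ Δ'⌋₊, ∑ m ∈ Icc 1 ⌊qhat q ^ Δ'⌋₊,
              ((mollifierCoeff (X ^ 2) (qhat q ^ Δ') l * mollifierCoeff (X ^ 2) (qhat q ^ Δ') m : ℝ) : ℂ) *
                offDiag q l m).re ≤ U * mainScaleReal Δ' q := by
  -- one funded piece `P′ = coreP + coreL + coreX = (FP + FL + FX) + (UP + UL + UX)`, `S′ = coreS`, `L′ = X′ = 0`
  refine offDiagBelowSlack_io_of_pieces_coreHeight hε₀ hε₁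
    (fun Δ' N ↦ coreP (goodPrimes Δ' N) (coreHeight ε₀) Δ' + coreL (Rf Δ' N) (goodPrimes Δ' N) (coreHeight ε₀) Δ' +
      coreX (goodPrimes Δ' N) (coreHeight ε₀) Δ')
    (fun Δ' N ↦ coreS (Rf Δ' N) (goodPrimes Δ' N) (coreHeight ε₀) Δ')
    (fun _ _ ↦ 0) (fun _ _ ↦ 0)
    (fun Δ' N ↦ FP Δ' N + FL Δ' N + FX Δ' N) (fun Δ' N ↦ UP Δ' N + UL Δ' N + UX Δ' N)
    (fun Δ' h1 h2 ↦ ⟨40, fun N hN ↦ ?_⟩) (fun Δ' h1 h2 N ↦ ?_)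
    (funded_of_eventually_eq_add_add _ FP FL FX (fun Δ' _ _ ↦ ⟨0, fun N _ ↦ rfl⟩) hFP hFL hFX)
    (fun Δ' _ _ ε hε ↦ ⟨0, fun N _ ↦ by
      simpa using mul_nonneg hε.le (Finset.sum_nonneg fun q _ ↦ mainScaleReal_nonneg Δ' q)⟩)
    (fun Δ' _ _ ε hε ↦ ⟨0, fun N _ ↦ by
      simpa using mul_nonneg hε.le (Finset.sum_nonneg fun q _ ↦ mainScaleReal_nonneg Δ' q)⟩)
    (fun c₀' hc₀' ↦ ?_)
  · -- the eventual identity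
    rw [sum_offDiagCore_goodPrimes_eq_pieces hN (lt_trans zero_lt_one h1) h2.le (hRf Δ' N) (coreHeight ε₀)]
    ring
  · -- the split of the funded piece
    rw [hPsplit Δ' h1 h2 N, hLsplit Δ' h1 h2 N, hXsplit Δ' h1 h2 N]
    ring
  · -- the residual, re-associated
    obtain ⟨b, hb, Hb⟩ := hR c₀' hc₀'
    refine ⟨b, hb, fun Δ' h1 h2 ↦ ?_⟩
    obtain ⟨U', hU', a₀, ha₀, η', hη', hη'c, N₀, HN⟩ := Hb Δ' h1 h2
    refine ⟨U', hU', a₀, ha₀, η', hη', hη'c, N₀, fun N hN hclean ↦ ?_⟩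
    have h := HN N hN hclean
    linarith

end Summit.Parity.GeneralizedHardyLittlewood.Theorems.BeyondDiagonalBeatsQuarter.OffDiag

end
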